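import Summits.NavierStokesRegularity.FluidComputer.TubeTableFat18
import HarnessLib

/-!
# Kernel run of the fat restart tube, chunks 12 … 17 (bp3 gen 15)

HONEST FRAMING: low prior, high value-of-information experiment on Tao's machine paradigm; NOT a
claim that NS blows up.

Kernel evaluations (`decide +kernel`; no `native_decide`, no extra axioms) of the in-tree tube checker
`runTube` (`P = 60`, 12 Taylor terms, cube `Rt`, read-out `CLt`) on the chunks `cF 12 … cF 17` of
`TubeTableFat18.lean`, each from the recorded boundary state `sF i` to `sF (i+1)`.

[cite: Tao2016AveragedNS, §5.5 Thm 5.3 (5.5)]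
-/

namespace Summit.NavierStokesRegularity.FluidComputer

namespace TubeTableFat18

open Literature.Analysis.FluidPDE.FluidComputer Literature.Analysis.FluidPDE.FluidComputer.TubeTable
open Literature.Analysis.FluidPDE.FluidComputer.ThresholdLevelTable (GIt)

set_option maxHeartbeats 10000000 in
set_option maxRecDepth 200000 in
/-- Chunk 12 of the fat tube run (steps 600 … 649, `h = 2^-11`). [folklore] -/
theorem runF_12 : runTube 60 12 GIt CLt Rt (sF 12) (cF 12) = some (sF (12 + 1)) := by
  decide +kernel

set_option maxHeartbeats 10000000 in
set_option maxRecDepth 200000 in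
/-- Chunk 13 of the fat tube run (steps 650 … 699, `h = 2^-11`). [folklore] -/
theorem runF_13 : runTube 60 12 GIt CLt Rt (sF 13) (cF 13) = some (sF (13 + 1)) := by
  decide +kernel

set_option maxHeartbeats 10000000 in
set_option maxRecDepth 200000 in
/-- Chunk 14 of the fat tube run (steps 700 … 749, `h = 2^-11`). [folklore] -/
theorem runF_14 : runTube 60 12 GIt CLt Rt (sF 14) (cF 14) = some (sF (14 + 1)) := by
  decide +kernel

set_option maxHeartbeats 10000000 in
set_option maxRecDepth 200000 in
/-- Chunk 15 of the fat tube run (steps 750 … 799, `h = 2^-11`). [folklore] -/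
theorem runF_15 : runTube 60 12 GIt CLt Rt (sF 15) (cF 15) = some (sF (15 + 1)) := by
  decide +kernel

set_option maxHeartbeats 10000000 in
set_option maxRecDepth 200000 in
/-- Chunk 16 of the fat tube run (steps 800 … 849, `h = 2^-11`). [folklore] -/
theorem runF_16 : runTube 60 12 GIt CLt Rt (sF 16) (cF 16) = some (sF (16 + 1)) := by
  decide +kernel

set_option maxHeartbeats 10000000 in
set_option maxRecDepth 200000 in
/-- Chunk 17 of the fat tube run (steps 850 … 899, `h = 2^-11`). [folklore] -/
theorem runF_17 : runTube 60 12 GIt CLt Rt (sF 17) (cF 17) = some (sF (17 + 1)) := by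
  decide +kernel

end TubeTableFat18

end Summit.NavierStokesRegularity.FluidComputer
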